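import Summits.AtomisticToContinuum.HydrodynamicLimit.Theorems.OneFlightGossipEngineEnergyCurrentTailsLevelCensusSplitFloorRung0
import Summits.AtomisticToContinuum.HydrodynamicLimit.Theorems.OneFlightGossipEngineEnergyCurrentTailsLevelCensusMergeClasses
import Literature.MathematicalPhysics.KineticTheory.HardSphereCampbellWindows
import Literature.MathematicalPhysics.KineticTheory.HardSphereCampbellAEMeasurable
import HarnessLib

/-!
# Crux `EnergyCurrentTails` (stmt-AtomisticToContinuum-9235), line `quartic-schur-ledger`:
# rung-0 certificate of the split deficit SD — preliminaries

Helper file (`--supports stmt-AtomisticToContinuum-9235`) of the audit stub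
`stub_quarticSplitDeficitRung0` (the split deficit SD of the line at GLOBAL EQUILIBRIUM with drift,
`…Theorems.OneFlightGossipEngineEnergyCurrentTailsSplitDeficitRung0`).  Tools:

* `c5sd_lintegral_collisionPairSum_le` — the rung-0 FLUX CEILING of a window `(s, t]` for a measurable
  `ℝ≥0∞` mark of the two post-collisional velocities (the landed engine
  `localGibbsLaw_lintegral_le_of_le_collisionMarkSum`, p98294, along the orbit of `Φ_s z`; window
  monotonicity and the shift `campbell_collisionPairSum_flow_shift_Ioc`);
* Gaussian statics: the energy shell has positive Gaussian mass (`c5sd_gaussMeasure_shell_ne_zero`), the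
  flux-weighted quartic moment is finite (`c5sd_lintegral_fluxQuartic_ne_top`), and the flux of the THIN
  pair-energy shell `{E < ‖v‖²+‖w‖² < (1+1/(n+1))E}` tends to `0` (`c5sd_tendsto_thinFlux`: continuity
  from above of the finite flux measure `‖w−v‖ dN(u,θ)^{⊗2}`);
* ONE COLLISION (`c5sd_splitIndicator_le`): on the splitting event of level `E`
  (`‖v₁⁺‖², ‖v₂⁺‖² ≤ E < max ‖vᵢ⁻‖²`, seat c2's `splitEvent`) either the pair energy lies in the thin
  shell `(E, (1+η)E)` or `(E − ‖v₁⁺‖²)(E − ‖v₂⁺‖²) ≥ 0` forces `‖v₁⁺‖²‖v₂⁺‖² ≥ ηE²`; summed over the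
  collisions of a window (`c5sd_eventSum_le`) and integrated (`splitDeficitRung0_eventCount_le`, REGISTERED helper; the product
  functional being a.e.-measurable, `c5sd_aemeasurable_collisionPairSum`):
  `eventCount (s,t] (splitEvent E) ≤ E[CPS(𝟙_thin)] + (N+1)/(ηE²) · E[CPS((N+1)⁻¹ 2‖vᵢ⁺‖²‖vⱼ⁺‖²)]`;
* the bridge `c5sd_finsum_eq_collisionPairSum` from the routes' inline `∑ᶠ` form to collision pair sums
  (self-contained: this file does not import `…FluxCeilingGlue`, whose `ContactIntensityDomination` import is gone).

References: Cercignani–Illner–Pulvirenti 1994, §2.2 and App. 4.A; Gallagher–Saint-Raymond–Texier 2013,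
Prop. 4.1.1.
-/

noncomputable section

open MeasureTheory Set Filter Topology
open scoped ENNReal InnerProductSpace

namespace Summit.AtomisticToContinuum.HydrodynamicLimit.Theorems.QuarticSchurLedger

open Literature.MathematicalPhysics.KineticTheory Literature.Analysis.FluidPDE
open Literature.Analysis.FunctionSpaces
open Summit.AtomisticToContinuum.HydrodynamicLimit.Theorems.EnergyCurrentTailsLevelCensus

/-! ### Pathwise bookkeeping of `ℝ≥0∞` collision pair sums -/

section Pathwise

variable {d X : Type*} [Fintype d] [MeasureSpace X] [TopologicalSpace X] {G : Geometry d X}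
  {ε : ℝ} {n : ℕ}

/-- Monotonicity of an `ℝ≥0∞`-valued collision pair sum in a bounded set of times, on the good set
(finitely many collision times in a bounded window). [folklore] -/
theorem c5sd_collisionPairSum_mono_set (Φ : HardSphereFlow G ε n) {z : Config n d X}
    (hz : z ∈ Φ.good) {S T : Set ℝ} (hST : S ⊆ T) {a b : ℝ} (hT : T ⊆ Icc a b)
    (g : ℝ → Config n d X → Fin n → Fin n → ℝ≥0∞) :
    Φ.collisionPairSum S g z ≤ Φ.collisionPairSum T g z := by
  have hfinT := Φ.finite_collisionTimes_inter hz hT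
  have hfinS := Φ.finite_collisionTimes_inter hz (hST.trans hT)
  unfold HardSphereFlow.collisionPairSum
  rw [collisionPairSum_eq_finset_sum hfinS, collisionPairSum_eq_finset_sum hfinT]
  exact Finset.sum_le_sum_of_subset_of_nonneg
    (Set.Finite.toFinset_subset_toFinset.2 (inter_subset_inter_right _ hST)) fun _ _ _ => bot_le

/-- On the good set, the collision pair sum of a time-independent `ℝ≥0∞` mark over `(s, t]` along the
orbit of `z` is at most the one over `[0, t - s]` along the orbit of `Φ_s z` (group property,
`campbell_collisionPairSum_flow_shift_Ioc`, and `(0, t-s] ⊆ [0, t-s]`). [folklore] -/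
theorem c5sd_collisionPairSum_Ioc_le_Icc_flow (Φ : HardSphereFlow G ε n) {z : Config n d X}
    (hz : z ∈ Φ.good) (s t : ℝ) (g : Config n d X → Fin n → Fin n → ℝ≥0∞) :
    Φ.collisionPairSum (Ioc s t) (fun _ w i j => g w i j) z ≤
      Φ.collisionPairSum (Icc 0 (t - s)) (fun _ w i j => g w i j) (Φ.flow s z) := by
  have h := campbell_collisionPairSum_flow_shift_Ioc Φ hz s 0 (t - s) g
  rw [zero_add, sub_add_cancel] at h
  rw [← h]
  exact c5sd_collisionPairSum_mono_set Φ (Φ.mapsTo_good s hz) Ioc_subset_Icc_self Subset.rfl _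

end Pathwise

/-! ### The rung-0 flux ceiling of a window `(s, t]` -/

/-- **The rung-0 flux ceiling for the window `(s, t]`** (the landed engine
`localGibbsLaw_lintegral_le_of_le_collisionMarkSum`, p98294, along the orbit of `Φ_s z`): for small
density, `N ≥ 1`, `s < t` and a measurable `ℝ≥0∞` mark `A` of the two (post-collisional) velocities,
`E_{G_N}[Σ_{collisions in (s,t]} Σ_{(i,j) in contact} A(vᵢ, vⱼ)] ≤ 16 (t−s)(N+1)² ε² ∫‖w−v‖ A dN(u,θ)^{⊗2}`.
[folklore] -/
theorem c5sd_lintegral_collisionPairSum_le {σ : ℝ} (hσ : 0 < σ)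
    (hsm : SmallDensity uniformProfile σ) {a θ : ℝ} (ha : 0 < a) (hθ : 0 < θ) (u : V3) {N : ℕ}
    (hN : 1 ≤ N) (Φ : HardSphereFlow (Torus.geometry (Fin 3)) (hsDiameter σ N) (N + 1))
    {A : V3 × V3 → ℝ≥0∞} (hAm : Measurable A) {s t : ℝ} (hst : s < t) :
    ∫⁻ z, Φ.collisionPairSum (Ioc s t) (fun _ w i j => A ((w i).2, (w j).2)) z
        ∂(localGibbsLaw σ (fun _ => a) (fun _ => u) (fun _ => θ) N Φ) ≤
      ENNReal.ofReal (16 * (t - s) * ((N + 1 : ℕ) : ℝ) ^ 2 * hsDiameter σ N ^ 2) *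
        ∫⁻ p, ENNReal.ofReal ‖p.2 - p.1‖ * A p ∂((gaussMeasure u θ).prod (gaussMeasure u θ)) :=
  localGibbsLaw_lintegral_le_of_le_collisionMarkSum hsm.σ_lt_half.le ha hθ u Φ
    (measurePreserving_flow_localGibbsLaw_const σ a θ u N Φ)
    (fun i j hij T hT => posGibbs_pairEvent_le hsm hN hij hT)
    (fun h hh => exists_sweptTube (hsDiameter_pos hσ N) hh)
    (fun S hS => by simpa only [sub_zero] using volume_setOf_exists_reprSym_add_latticeVec_mem_le 0 hS)
    (sub_pos.2 hst) hAm s (fun z hz => c5sd_collisionPairSum_Ioc_le_Icc_flow Φ hz s t _)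

/-! ### Gaussian statics -/

/-- A non-degenerate drifted Gaussian charges every set containing a nonempty open set (positive
density `localMaxwellian` with respect to Lebesgue measure, which charges open sets). [folklore] -/
theorem c5sd_gaussMeasure_ne_zero_of_isOpen (u : V3) {θ : ℝ} (hθ : 0 < θ) {U S : Set V3}
    (hU : IsOpen U) (hne : U.Nonempty) (hUS : U ⊆ S) : gaussMeasure u θ S ≠ 0 := by
  intro h0
  have hM : Measurable fun v : V3 => ENNReal.ofReal (localMaxwellian 1 θ u v) :=
    (continuous_localMaxwellian 1 θ u).measurable.ennreal_ofReal
  have hU0 : gaussMeasure u θ U = 0 := measure_mono_null hUS h0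
  rw [← withDensity_localMaxwellian_eq_gaussMeasure hθ u, withDensity_apply _ hU.measurableSet] at hU0
  have hae := (setLIntegral_eq_zero_iff hU.measurableSet hM).1 hU0
  have hnull : (volume : Measure V3) U = 0 :=
    measure_eq_zero_iff_ae_notMem.2 (hae.mono fun x hx hxU =>
      (ENNReal.ofReal_pos.2 (localMaxwellian_pos one_pos hθ u x)).ne' (hx hxU))
  exact (hU.measure_pos (μ := (volume : Measure V3)) hne).ne' hnull

/-- The energy shell `{E < ‖v‖² ≤ 3E/2}` has positive Gaussian mass for `E > 0`. [folklore] -/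
theorem c5sd_gaussMeasure_shell_ne_zero (u : V3) {θ : ℝ} (hθ : 0 < θ) {E : ℝ} (hE : 0 < E) :
    gaussMeasure u θ {v : V3 | E < ‖v‖ ^ 2 ∧ ‖v‖ ^ 2 ≤ 3 / 2 * E} ≠ 0 := by
  have hc : Continuous fun v : V3 => ‖v‖ ^ 2 := by fun_prop
  refine c5sd_gaussMeasure_ne_zero_of_isOpen u hθ
    (U := {v : V3 | E < ‖v‖ ^ 2} ∩ {v : V3 | ‖v‖ ^ 2 < 3 / 2 * E})
    ((isOpen_lt continuous_const hc).inter (isOpen_lt hc continuous_const)) ?_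
    fun v hv => ⟨hv.1, le_of_lt hv.2⟩
  obtain ⟨v, hv⟩ := exists_norm_eq V3 (Real.sqrt_nonneg (5 / 4 * E))
  have hn : ‖v‖ ^ 2 = 5 / 4 * E := by rw [hv, Real.sq_sqrt (by positivity)]
  refine ⟨v, ?_, ?_⟩
  · show E < ‖v‖ ^ 2
    rw [hn]; linarith
  · show ‖v‖ ^ 2 < 3 / 2 * E
    rw [hn]; linarith

/-- **The flux-weighted Gaussian quartic moment is finite**:
`∫‖w − v‖(‖v‖² + ‖w‖²)² dN(u,θ)^{⊗2} < ∞` (fifth Gaussian moments). [folklore] -/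
theorem c5sd_lintegral_fluxQuartic_ne_top (u : V3) (θ : ℝ) :
    ∫⁻ p, ENNReal.ofReal ‖p.2 - p.1‖ * ENNReal.ofReal ((‖p.1‖ ^ 2 + ‖p.2‖ ^ 2) ^ 2)
        ∂((gaussMeasure u θ).prod (gaussMeasure u θ)) ≠ ⊤ := by
  have h5 : Integrable (fun v : V3 => ‖v‖ ^ 5) (gaussMeasure u θ) := by
    have := (ProbabilityTheory.IsGaussian.memLp_id (gaussMeasure u θ) ((5 : ℕ) : ℝ≥0∞)
      (by simp)).integrable_norm_pow (by norm_num)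
    simpa using this
  have hG : Integrable (fun p : V3 × V3 => 4 * (‖p.1‖ ^ 5 + ‖p.2‖ ^ 5))
      ((gaussMeasure u θ).prod (gaussMeasure u θ)) :=
    ((h5.comp_fst (gaussMeasure u θ)).add (h5.comp_snd (gaussMeasure u θ))).const_mul 4
  refine ne_of_lt (lt_of_le_of_lt (lintegral_mono fun p => ?_) hG.lintegral_lt_top)
  rw [← ENNReal.ofReal_mul (norm_nonneg _)]
  refine ENNReal.ofReal_le_ofReal ?_
  have h1 : ‖p.2 - p.1‖ ≤ ‖p.1‖ + ‖p.2‖ := (norm_sub_le _ _).trans_eq (add_comm _ _)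
  have h2 := add_mul_sq_add_sq_sq_le (norm_nonneg p.1) (norm_nonneg p.2)
  calc ‖p.2 - p.1‖ * (‖p.1‖ ^ 2 + ‖p.2‖ ^ 2) ^ 2
      ≤ (‖p.1‖ + ‖p.2‖) * (‖p.1‖ ^ 2 + ‖p.2‖ ^ 2) ^ 2 :=
        mul_le_mul_of_nonneg_right h1 (by positivity)
    _ = 4 * ((‖p.1‖ + ‖p.2‖) * ((‖p.1‖ ^ 2 + ‖p.2‖ ^ 2) ^ 2 / 4)) := by ring
    _ ≤ 4 * (‖p.1‖ ^ 5 + ‖p.2‖ ^ 5) := by linarith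

/-- The thin pair-energy shell `{E < ‖v‖²+‖w‖² < c}` is a Borel set. [folklore] -/
theorem c5sd_measurableSet_thin (E c : ℝ) :
    MeasurableSet {p : V3 × V3 | E < ‖p.1‖ ^ 2 + ‖p.2‖ ^ 2 ∧ ‖p.1‖ ^ 2 + ‖p.2‖ ^ 2 < c} := by
  have hT : Measurable fun p : V3 × V3 => ‖p.1‖ ^ 2 + ‖p.2‖ ^ 2 := by fun_prop
  exact (measurableSet_lt measurable_const hT).inter (measurableSet_lt hT measurable_const)

/-- **The flux of the thin pair-energy shell vanishes in the limit**: with `η = 1/(n+1)`,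
`Θ(η) = ∫‖w−v‖ 𝟙{E < ‖v‖²+‖w‖² < (1+η)E} dN(u,θ)^{⊗2} → 0` as `n → ∞` (`E > 0`; the shells decrease to
the empty set and the flux measure `‖w−v‖ dN^{⊗2}` is finite). [folklore] -/
theorem c5sd_tendsto_thinFlux (u : V3) (θ : ℝ) {E : ℝ} (hE : 0 < E) :
    Tendsto (fun n : ℕ => ∫⁻ p, ENNReal.ofReal ‖p.2 - p.1‖ *
        {p : V3 × V3 | E < ‖p.1‖ ^ 2 + ‖p.2‖ ^ 2 ∧
          ‖p.1‖ ^ 2 + ‖p.2‖ ^ 2 < (1 + 1 / ((n : ℝ) + 1)) * E}.indicator (fun _ => (1 : ℝ≥0∞)) p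
        ∂((gaussMeasure u θ).prod (gaussMeasure u θ))) atTop (𝓝 0) := by
  set μ : Measure (V3 × V3) := (gaussMeasure u θ).prod (gaussMeasure u θ) with hμ
  set sh : ℕ → Set (V3 × V3) := fun n => {p : V3 × V3 | E < ‖p.1‖ ^ 2 + ‖p.2‖ ^ 2 ∧
    ‖p.1‖ ^ 2 + ‖p.2‖ ^ 2 < (1 + 1 / ((n : ℝ) + 1)) * E} with hsh
  have hshm : ∀ n, MeasurableSet (sh n) := fun n => c5sd_measurableSet_thin E _
  -- the integrand as a set integral
  have heq : ∀ n, ∫⁻ p, ENNReal.ofReal ‖p.2 - p.1‖ * (sh n).indicator (fun _ => (1 : ℝ≥0∞)) p ∂μ =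
      ∫⁻ p in sh n, ENNReal.ofReal ‖p.2 - p.1‖ ∂μ := by
    intro n
    rw [← lintegral_indicator (hshm n)]
    refine lintegral_congr fun p => ?_
    by_cases hp : p ∈ sh n
    · rw [indicator_of_mem hp, indicator_of_mem hp, mul_one]
    · rw [indicator_of_notMem hp, indicator_of_notMem hp, mul_zero]
  show Tendsto (fun n : ℕ => ∫⁻ p, ENNReal.ofReal ‖p.2 - p.1‖ *
    (sh n).indicator (fun _ => (1 : ℝ≥0∞)) p ∂μ) atTop (𝓝 0)
  simp_rw [heq]
  -- the flux measure is finite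
  have h1 : Integrable (fun v : V3 => ‖v‖) (gaussMeasure u θ) :=
    (ProbabilityTheory.IsGaussian.integrable_id (μ := gaussMeasure u θ)).norm
  have hG : Integrable (fun p : V3 × V3 => ‖p.1‖ + ‖p.2‖) μ :=
    (h1.comp_fst (gaussMeasure u θ)).add (h1.comp_snd (gaussMeasure u θ))
  have hfin : ∫⁻ p, ENNReal.ofReal ‖p.2 - p.1‖ ∂μ ≠ ⊤ := by
    refine ne_of_lt (lt_of_le_of_lt (lintegral_mono fun p => ?_) hG.lintegral_lt_top)
    exact ENNReal.ofReal_le_ofReal ((norm_sub_le _ _).trans_eq (add_comm _ _))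
  -- the shells decrease to the empty set
  have hanti : Antitone sh := by
    intro m n hmn p hp
    have h1 : 1 / ((n : ℝ) + 1) ≤ 1 / ((m : ℝ) + 1) :=
      one_div_le_one_div_of_le (by positivity) (by exact_mod_cast Nat.succ_le_succ hmn)
    exact ⟨hp.1, hp.2.trans_le (mul_le_mul_of_nonneg_right (by linarith) hE.le)⟩
  have hempty : (⋂ n, sh n) = ∅ := by
    refine Set.eq_empty_iff_forall_notMem.2 fun p hp => ?_
    rw [mem_iInter] at hp
    have h0 : E < ‖p.1‖ ^ 2 + ‖p.2‖ ^ 2 := (hp 0).1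
    obtain ⟨n, hn⟩ := exists_nat_one_div_lt (div_pos (sub_pos.2 h0) hE)
    have h2 := (hp n).2
    have h3 : (1 + 1 / ((n : ℝ) + 1)) * E < ‖p.1‖ ^ 2 + ‖p.2‖ ^ 2 := by
      calc (1 + 1 / ((n : ℝ) + 1)) * E < (1 + (‖p.1‖ ^ 2 + ‖p.2‖ ^ 2 - E) / E) * E :=
            mul_lt_mul_of_pos_right (by linarith) hE
        _ = ‖p.1‖ ^ 2 + ‖p.2‖ ^ 2 := by field_simp; ring
    linarith
  have hmeas : Tendsto (μ ∘ sh) atTop (𝓝 0) := by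
    have h := tendsto_measure_iInter_atTop (μ := μ) (fun n => (hshm n).nullMeasurableSet) hanti
      ⟨0, measure_ne_top _ _⟩
    rwa [hempty, measure_empty] at h
  exact tendsto_setLIntegral_zero hfin hmeas

/-! ### One collision: the splitting indicator versus the thin shell and the product mark -/

/-- **One collision.**  For `E, η > 0` and a velocity event `((v₁⁻,v₂⁻),(v₁⁺,v₂⁺))` conserving the pair
energy: on the splitting event of level `E` (`‖v₁⁺‖², ‖v₂⁺‖² ≤ E < max ‖vᵢ⁻‖²`) either the pair energy
`‖v₁⁺‖²+‖v₂⁺‖²` lies in the thin shell `(E, (1+η)E)`, or `(E − ‖v₁⁺‖²)(E − ‖v₂⁺‖²) ≥ 0` forces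
`‖v₁⁺‖²‖v₂⁺‖² ≥ ηE²`; hence `𝟙_split ≤ 𝟙_thin(v⁺) + (ηE²)⁻¹ · 2‖v₁⁺‖²‖v₂⁺‖²`. [folklore] -/
theorem c5sd_splitIndicator_le {E η : ℝ} (hE : 0 < E) (hη : 0 < η) (pre post : V3 × V3)
    (hq : ‖pre.1‖ ^ 2 + ‖pre.2‖ ^ 2 = ‖post.1‖ ^ 2 + ‖post.2‖ ^ 2) :
    (splitEvent E).indicator (fun _ => (1 : ℝ≥0∞)) (pre, post) ≤
      {p : V3 × V3 | E < ‖p.1‖ ^ 2 + ‖p.2‖ ^ 2 ∧ ‖p.1‖ ^ 2 + ‖p.2‖ ^ 2 < (1 + η) * E}.indicator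
          (fun _ => (1 : ℝ≥0∞)) post +
        ENNReal.ofReal ((η * E ^ 2)⁻¹ * (2 * (‖post.1‖ ^ 2 * ‖post.2‖ ^ 2))) := by
  by_cases hmem : ((pre, post) : VelEvent) ∈ splitEvent E
  · rw [indicator_of_mem hmem]
    have h1 : E < maxPre (pre, post) := hmem.1
    have h3 : ‖post.1‖ ^ 2 ≤ E := hmem.2.2.1
    have h4 : ‖post.2‖ ^ 2 ≤ E := hmem.2.2.2
    have hmax : maxPre (pre, post) ≤ ‖pre.1‖ ^ 2 + ‖pre.2‖ ^ 2 :=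
      max_le (le_add_of_nonneg_right (by positivity)) (le_add_of_nonneg_left (by positivity))
    have hsum : E < ‖post.1‖ ^ 2 + ‖post.2‖ ^ 2 := by linarith
    by_cases hthin : ‖post.1‖ ^ 2 + ‖post.2‖ ^ 2 < (1 + η) * E
    · have hm : post ∈ {p : V3 × V3 | E < ‖p.1‖ ^ 2 + ‖p.2‖ ^ 2 ∧
          ‖p.1‖ ^ 2 + ‖p.2‖ ^ 2 < (1 + η) * E} := ⟨hsum, hthin⟩
      rw [indicator_of_mem hm]
      exact le_self_add
    · have hthin := not_lt.1 hthin
      have hxy : η * E ^ 2 ≤ ‖post.1‖ ^ 2 * ‖post.2‖ ^ 2 := by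
        nlinarith [mul_nonneg (sub_nonneg.2 h3) (sub_nonneg.2 h4),
          mul_le_mul_of_nonneg_left hthin hE.le]
      have hone : (1 : ℝ) ≤ (η * E ^ 2)⁻¹ * (2 * (‖post.1‖ ^ 2 * ‖post.2‖ ^ 2)) := by
        rw [inv_mul_eq_div, le_div_iff₀ (by positivity)]
        nlinarith
      calc (1 : ℝ≥0∞) = ENNReal.ofReal 1 := ENNReal.ofReal_one.symm
        _ ≤ ENNReal.ofReal ((η * E ^ 2)⁻¹ * (2 * (‖post.1‖ ^ 2 * ‖post.2‖ ^ 2))) :=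
            ENNReal.ofReal_le_ofReal hone
        _ ≤ _ := le_add_self
  · rw [indicator_of_notMem hmem]
    exact bot_le

/-- **Pathwise: the splitting count of a window is dominated by the thin-shell count plus the
product functional.**  On the good set, for `E, η > 0` and every window `(s, t]`,
`eventSum Φ s t (splitEvent E) z ≤ CPS_{(s,t]}(𝟙_thin(vᵢ⁺,vⱼ⁺)) + (N+1)/(ηE²) · CPS_{(s,t]}((N+1)⁻¹ 2‖vᵢ⁺‖²‖vⱼ⁺‖²)`
(`c5sd_splitIndicator_le` term by term, dropping the once-per-collision guard; the record's
post-collisional velocities are those of the configuration, `ofConfig_norm_sq_preVel`). [folklore] -/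
theorem c5sd_eventSum_le {σ : ℝ} {N : ℕ} (Φ : Flow σ N) {z : Config (N + 1) (Fin 3) T3}
    (hz : z ∈ Φ.good) {E η : ℝ} (hE : 0 < E) (hη : 0 < η) (s t : ℝ) :
    eventSum Φ s t (splitEvent E) z ≤
      Φ.collisionPairSum (Ioc s t) (fun _ w i j =>
          {p : V3 × V3 | E < ‖p.1‖ ^ 2 + ‖p.2‖ ^ 2 ∧ ‖p.1‖ ^ 2 + ‖p.2‖ ^ 2 < (1 + η) * E}.indicator
            (fun _ => (1 : ℝ≥0∞)) ((w i).2, (w j).2)) z +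
        ENNReal.ofReal (((N + 1 : ℕ) : ℝ) / (η * E ^ 2)) *
          Φ.collisionPairSum (Ioc s t) (fun _ w i j =>
            ENNReal.ofReal (((N + 1 : ℕ) : ℝ)⁻¹ * (2 * (‖(w i).2‖ ^ 2 * ‖(w j).2‖ ^ 2)))) z := by
  have hfin := Φ.finite_collisionTimes_inter hz (Ioc_subset_Icc_self : Ioc s t ⊆ Icc s t)
  simp only [eventSum, HardSphereFlow.collisionSum_eq, HardSphereFlow.collisionPairSum,
    Literature.Analysis.FluidPDE.collisionSum_eq_collisionPairSum]
  rw [collisionPairSum_eq_finset_sum hfin, collisionPairSum_eq_finset_sum hfin,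
    collisionPairSum_eq_finset_sum hfin, Finset.mul_sum, ← Finset.sum_add_distrib]
  refine Finset.sum_le_sum fun τ _ => ?_
  rw [Finset.mul_sum, ← Finset.sum_add_distrib]
  refine Finset.sum_le_sum fun p _ => ?_
  have hN : ((N + 1 : ℕ) : ℝ) ≠ 0 := by positivity
  have hC : ENNReal.ofReal (((N + 1 : ℕ) : ℝ) / (η * E ^ 2)) *
      ENNReal.ofReal (((N + 1 : ℕ) : ℝ)⁻¹ * (2 * (‖(Φ.flow τ z p.1).2‖ ^ 2 * ‖(Φ.flow τ z p.2).2‖ ^ 2))) =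
      ENNReal.ofReal ((η * E ^ 2)⁻¹ * (2 * (‖(Φ.flow τ z p.1).2‖ ^ 2 * ‖(Φ.flow τ z p.2).2‖ ^ 2))) := by
    rw [← ENNReal.ofReal_mul (by positivity)]
    congr 1
    field_simp
  rw [hC]
  refine le_trans ?_ (c5sd_splitIndicator_le hE hη
    (HardSphereCollisionRecord.ofConfig (Torus.geometry (Fin 3)) (hsDiameter σ N) (Φ.flow τ z) τ p.1 p.2).preVel
    ((Φ.flow τ z p.1).2, (Φ.flow τ z p.2).2)
    (HardSphereCollisionRecord.ofConfig_norm_sq_preVel _ _ _ _ _ _))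
  split_ifs
  · exact le_rfl
  · exact bot_le

/-! ### In expectation -/

/-- The window collision pair sum of a measurable time-independent `ℝ≥0∞` mark is a.e.-measurable
under every local Gibbs law (`aemeasurable_collisionPairSum` under Liouville for the window
`(0, t−s]`, composed with the Liouville-preserving `Φ_s`, transported along `λ_N ≪ Liouville`, and the
shift identity on the conull good set). [folklore] -/
theorem c5sd_aemeasurable_collisionPairSum {σ : ℝ} (hσ : 0 < σ) (hσ2 : σ < 1 / 2) {N : ℕ}
    (a₀ θ₀ : T3 → ℝ) (u₀ : T3 → V3) (Φ : Flow σ N)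
    (g : Config (N + 1) (Fin 3) T3 → Fin (N + 1) → Fin (N + 1) → ℝ≥0∞)
    (hg : ∀ i j, Measurable fun w => g w i j) (s t : ℝ) :
    AEMeasurable (Φ.collisionPairSum (Ioc s t) (fun _ w i j => g w i j))
      (localGibbsLaw σ a₀ u₀ θ₀ N Φ) := by
  have hε : 0 < hsDiameter σ N := hsDiameter_pos hσ N
  have hε' : hsDiameter σ N < 1 / 2 := (hsDiameter_le hσ.le N).trans_lt hσ2
  have h0 : AEMeasurable (Φ.collisionPairSum (Ioc 0 (t - s)) (fun _ w i j => g w i j))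
      (liouville (Torus.geometry (Fin 3)) (N + 1) (hsDiameter σ N)) :=
    aemeasurable_collisionPairSum hε hε' Φ g hg (t - s)
  have h1 : AEMeasurable
      (fun z => Φ.collisionPairSum (Ioc 0 (t - s)) (fun _ w i j => g w i j) (Φ.flow s z))
      (localGibbsLaw σ a₀ u₀ θ₀ N Φ) :=
    (h0.comp_quasiMeasurePreserving (Φ.measurePreserving s).quasiMeasurePreserving).mono_ac
      (localGibbsLaw_absolutelyContinuous σ a₀ u₀ θ₀ N Φ)
  refine h1.congr ?_
  filter_upwards [ae_mem_good_localGibbsLaw σ a₀ u₀ θ₀ N Φ] with z hz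
  rw [campbell_collisionPairSum_flow_shift_Ioc Φ hz s 0 (t - s) g, zero_add, sub_add_cancel]

/-- **Registered helper `splitDeficitRung0_eventCount_le` — the splitting count versus the thin shell
and the product functional, in expectation** (stmt-AtomisticToContinuum-9235, line
`quartic-schur-ledger`, input of `stub_quarticSplitDeficitRung0`): for `0 < σ < 1/2`, every local Gibbs
law, every flow, `E, η > 0` and every window `(s, t]`,
`eventCount (s,t] (splitEvent E) ≤ E[CPS(𝟙_thin(vᵢ⁺,vⱼ⁺))] + (N+1)/(ηE²) · E[CPS((N+1)⁻¹ 2‖vᵢ⁺‖²‖vⱼ⁺‖²)]`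
(`c5sd_eventSum_le` a.e. on the conull good set; the product functional is a.e.-measurable,
`c5sd_aemeasurable_collisionPairSum`). [folklore] -/
theorem splitDeficitRung0_eventCount_le : ∀ (σ : ℝ), 0 < σ → σ < 1 / 2 → ∀ (a₀ θ₀ : T3 → ℝ) (u₀ : T3 → V3) (N : ℕ) (Φ : Flow σ N) (E η : ℝ), 0 < E → 0 < η → ∀ (s t : ℝ), eventCount σ a₀ θ₀ u₀ N Φ s t (splitEvent E) ≤ (∫⁻ z, Φ.collisionPairSum (Set.Ioc s t) (fun _ w i j => {p : V3 × V3 | E < ‖p.1‖ ^ 2 + ‖p.2‖ ^ 2 ∧ ‖p.1‖ ^ 2 + ‖p.2‖ ^ 2 < (1 + η) * E}.indicator (fun _ => (1 : ℝ≥0∞)) ((w i).2, (w j).2)) z ∂(localGibbsLaw σ a₀ u₀ θ₀ N Φ)) + ENNReal.ofReal (((N + 1 : ℕ) : ℝ) / (η * E ^ 2)) * ∫⁻ z, Φ.collisionPairSum (Set.Ioc s t) (fun _ w i j => ENNReal.ofReal (((N + 1 : ℕ) : ℝ)⁻¹ * (2 * (‖(w i).2‖ ^ 2 * ‖(w j).2‖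 ^ 2)))) z ∂(localGibbsLaw σ a₀ u₀ θ₀ N Φ) := by
  intro σ hσ hσ2 a₀ θ₀ u₀ N Φ E η hE hη s t
  have hgood := ae_mem_good_localGibbsLaw σ a₀ u₀ θ₀ N Φ
  have hgm : ∀ i j : Fin (N + 1), Measurable fun w : Config (N + 1) (Fin 3) T3 =>
      ENNReal.ofReal (((N + 1 : ℕ) : ℝ)⁻¹ * (2 * (‖(w i).2‖ ^ 2 * ‖(w j).2‖ ^ 2))) :=
    fun i j => (((((measurable_pi_apply i).snd.norm.pow_const 2).mul
      ((measurable_pi_apply j).snd.norm.pow_const 2)).const_mul 2).const_mul _).ennreal_ofReal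
  have hmeas : AEMeasurable (Φ.collisionPairSum (Ioc s t) (fun _ w i j =>
      ENNReal.ofReal (((N + 1 : ℕ) : ℝ)⁻¹ * (2 * (‖(w i).2‖ ^ 2 * ‖(w j).2‖ ^ 2)))))
      (localGibbsLaw σ a₀ u₀ θ₀ N Φ) :=
    c5sd_aemeasurable_collisionPairSum hσ hσ2 a₀ θ₀ u₀ Φ
      (fun w i j => ENNReal.ofReal (((N + 1 : ℕ) : ℝ)⁻¹ * (2 * (‖(w i).2‖ ^ 2 * ‖(w j).2‖ ^ 2))))
      hgm s t
  have hle : ∀ᵐ z ∂(localGibbsLaw σ a₀ u₀ θ₀ N Φ), eventSum Φ s t (splitEvent E) z ≤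
      Φ.collisionPairSum (Ioc s t) (fun _ w i j =>
          {p : V3 × V3 | E < ‖p.1‖ ^ 2 + ‖p.2‖ ^ 2 ∧ ‖p.1‖ ^ 2 + ‖p.2‖ ^ 2 < (1 + η) * E}.indicator
            (fun _ => (1 : ℝ≥0∞)) ((w i).2, (w j).2)) z +
        ENNReal.ofReal (((N + 1 : ℕ) : ℝ) / (η * E ^ 2)) *
          Φ.collisionPairSum (Ioc s t) (fun _ w i j =>
            ENNReal.ofReal (((N + 1 : ℕ) : ℝ)⁻¹ * (2 * (‖(w i).2‖ ^ 2 * ‖(w j).2‖ ^ 2)))) z :=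
    hgood.mono fun z hz => c5sd_eventSum_le Φ hz hE hη s t
  refine (lintegral_mono_ae hle).trans (le_of_eq ?_)
  rw [lintegral_add_right' _ (hmeas.const_mul _), lintegral_const_mul'' _ hmeas]

/-! ### The bridge from the routes' inline form -/

/-- On the good set, the routes' inline `∑ᶠ`-over-collision-times functional of a mark `g(y, i, j)` is
the collision pair sum of `g` along the flow (the orbit stays in the hard-sphere domain, where the sum
over the ordered contact pairs is the guarded double sum, `sum_contactPairs_eq`). [folklore] -/
theorem c5sd_finsum_eq_collisionPairSum {d X : Type*} [Fintype d] [MeasureSpace X]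
    [TopologicalSpace X] {G : Geometry d X} {ε : ℝ} {n : ℕ} {M : Type*} [AddCommMonoid M]
    (Φ : HardSphereFlow G ε n) {z : Config n d X} (hz : z ∈ Φ.good) (S : Set ℝ)
    (g : Config n d X → Fin n → Fin n → M) :
    (∑ᶠ τ ∈ collisionTimes G ε (fun r => Φ.flow r z) ∩ S, ∑ i : Fin n, ∑ j : Fin n,
        if i = j then (0 : M) else (contactSet G n ε i j).indicator (fun y => g y i j) (Φ.flow τ z)) =
      Φ.collisionPairSum S (fun _ w i j => g w i j) z := by
  unfold HardSphereFlow.collisionPairSum Literature.Analysis.FluidPDE.collisionPairSum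
  refine finsum_mem_congr rfl fun τ _ => ?_
  have hy : Φ.flow τ z ∈ hardSphereDomain G n ε := (Φ.isTrajectory z hz).mem τ
  rw [sum_contactPairs_eq hy]
  refine Finset.sum_congr rfl fun i _ => Finset.sum_congr rfl fun j _ => ?_
  by_cases hij : i = j
  · simp [hij]
  · by_cases hc : ‖G.sepVec (Φ.flow τ z i).1 (Φ.flow τ z j).1‖ = ε
    · have hmem : Φ.flow τ z ∈ contactSet G n ε i j := mem_contactSet.2 ⟨hy, hc⟩
      simp [hij, hc, Set.indicator_of_mem hmem]
    · have hnmem : Φ.flow τ z ∉ contactSet G n ε i j := fun h => hc (mem_contactSet.1 h).2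
      simp [hij, hc, Set.indicator_of_notMem hnmem]

end Summit.AtomisticToContinuum.HydrodynamicLimit.Theorems.QuarticSchurLedger

end
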